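import Literature.AlgebraicGeometry.Motives.Varieties
import Mathlib.Analysis.Complex.Basic
import HarnessLib

/-!
# The generic projection cone of Chow's moving lemma (Roberts' Main Lemma) — named fact

For a non-singular projective variety `X ⊆ ℙᵐ` of dimension `n` over an algebraically closed field,
irreducible subvarieties `V, W ⊆ X`, and the linear projection `π_L : X → ℙⁿ` from a generic linear
centre `L ≅ ℙ^{m−n−1}` (a finite morphism, `L ∩ X = ∅`), W. Fulton, *Intersection Theory* (2nd ed.
1998), §11.4, Example 11.4.1 states, with `C_L = C_L(V)` the cone over `V` with vertex `L`, so that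
`X ∩ C_L = π_L⁻¹(π_L(V))`:

* (a) for generic `L`, `C_L` meets `X` properly, and the intersection is generically transversal
  along `V`, i.e. `π_L^*[C_L] = [V] + γ_L` where the cycle `γ_L` does not contain `V`;
* (b) if `dim (V ∩ W) = dim V + dim W − n + e` with `e > 0` (improper intersection), then, for
  generic `L`, every component `Vᵢ` of `γ_L` satisfies `dim (Vᵢ ∩ W) < dim (V ∩ W)`.

The proofs ("counting constants") are J. Roberts, *Chow's moving lemma*, in: Algebraic Geometry,
Oslo 1970 (F. Oort ed.), Wolters-Noordhoff 1972, pp. 89–96: Main Lemma (the excess count (b), in the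
sharper form `e(γ_L, W) ≤ max (e(V, W) − 1, 0)`) and Lemma 3 / §2 (finiteness of `π_L`, proper
intersection and generic transversality (a)); see also C. Voisin, *Hodge Theory and Complex Algebraic
Geometry II*, §9.2.4, Lemma 9.22. This file NAMES the statement (a)–(b) as a fact, in the set- and
point-theoretic vocabulary of the layer (`Motives/Varieties`: `SchemeOver`, `IsSmoothProjective`,
`projectiveSpace`; codimension of a point = `Order.coheight` for the specialisation order, as in
`Motives/CyclesDimension`, `Motives/FiniteMorphismCodimension`), specialised to the case the layer
consumes: ground field `ℂ`, `X` smooth projective, `codim V = l ≥ 1`: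

* `Roberts1972_genericProjection` — there are a FINITE `φ : X ⟶ ℙⁿ` (in print `π_L`) and a closed
  `Z' ⊆ X` (in print the support of `γ_L`, i.e. the union of the components of `X ∩ C_L` other than
  `V`) with `V ⊄ Z'`, `codim Z' ≥ l` ((a), proper intersection), `φ⁻¹(φ V) ⊆ V ∪ Z'`
  (`X ∩ C_L = V ∪ |γ_L|`), every point of `Z' ∩ W` of codimension larger than that of some point of
  `V ∩ W` ((b): `dim (Vᵢ ∩ W) < dim (V ∩ W)`), and `φ` SMOOTH on an open subscheme of `X` meeting `V`
  ((a), generic transversality along `V`: the finite flat `π_L` is unramified, i.e. étale, at the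
  generic point of `V` — for `v ∈ V` this says `L` misses the embedded tangent space `𝕋_v X`).

Multiplicities are not part of the layer's vocabulary (no intersection cycles `π_L^*[C_L]` yet), so
(a) is rendered by its two set- and scheme-theoretic consequences used downstream (properness of
`X ∩ C_L` and étaleness of `π_L` generically on `V`); the genericity of `L` in the Grassmannian is
rendered as existence. Consumers: the cone step of Chow's moving lemma on the coniveau carrier
(`HodgeTheory/MovingLemmaExcessInduction`, hypothesis `hstep`; crux line
`Summits/HodgeConjecture/…/Cruxes/HodgeBeyondAnchors/Lines/andre_motivated_split.lean`), hence
`HodgeTheory.Voisin2003_cupProduct_algebraicClasses` and `HodgeTheory.fulton1998_map_mem_algebraicClasses`.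
Status: a THEOREM in print, unproved in the tree (generic linear projections, joins/cones and
Roberts' dimension counts are not formalised). Nothing else is in this file.

-- TODO(general form): any algebraically closed ground field; `X` non-singular QUASI-projective with
-- a closed imbedding into an open `U ⊆ ℙᵐ`; the cycle-level identity `π_L^*[C_L] = [V] + γ_L` and
-- Roberts' bound `e(γ_L, W) ≤ max (e(V, W) − 1, 0)`, for `L` in a dense open subset of the
-- Grassmannian `G(m − n − 1, m)`.

## References
* [Fulton1998] W. Fulton, Intersection Theory, 2nd ed., Springer 1998, §11.4 Example 11.4.1 (a)–(b) (p. 206).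
* [Roberts1972] J. Roberts, Chow's moving lemma, Algebraic Geometry (Oslo 1970), Wolters-Noordhoff 1972, 89–96: Main Lemma, §2.
* [VoisinHodgeII2003] C. Voisin, Hodge Theory and Complex Algebraic Geometry II, CUP 2003, §9.2.4 Lemma 9.22.

#harness_tags algebraic_geometry.projective_varieties, algebraic_geometry.finite_morphisms
-/

noncomputable section

open CategoryTheory AlgebraicGeometry Set Order

namespace Literature.AlgebraicGeometry.Motives

/-- **Roberts' generic projection cone (Fulton, *Intersection Theory*, Example 11.4.1 (a)–(b); proofs
in Roberts, *Chow's moving lemma*, Main Lemma and §2).** Printed statement: for `Xⁿ ⊆ ℙᵐ`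
non-singular projective over an algebraically closed field, `V, W ⊆ X` irreducible subvarieties and
`L ≅ ℙ^{m−n−1}` a generic linear subspace, with `C_L` the cone over `V` with vertex `L` and
`π_L : X → ℙⁿ` the (finite) linear projection: (a) `C_L` meets `X` properly and generically
transversally along `V`, `π_L^*[C_L] = [V] + γ_L` with `γ_L` not containing `V`; (b) if
`dim (V ∩ W) > dim V + dim W − n` then `dim (Vᵢ ∩ W) < dim (V ∩ W)` for every component `Vᵢ` of `γ_L`.
Here, over `ℂ`, for `X` smooth projective of dimension `n`, `V = Z` irreducible closed of codimension
exactly `l ≥ 1`, `W` irreducible closed of codimension `≥ k`, meeting improperly (a point of `Z ∩ W`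
of codimension `< l + k`): there are a finite `φ : X ⟶ ℙⁿ_ℂ` and a closed `Z' ⊆ X` with `Z ⊄ Z'`,
all points of `Z'` of codimension `≥ l`, `φ⁻¹(φ Z) ⊆ Z ∪ Z'`, every point of `Z' ∩ W` of
codimension exceeding that of some point of `Z ∩ W`, and `φ` smooth (étale) on an open subscheme
meeting `Z`. Codimension of a point `x` is `Order.coheight x` in the specialisation order
(`= n − dim {x}⁻`). [cite: Fulton1998, §11.4 Example 11.4.1 (a)–(b)] [cite: Roberts1972, Main Lemma and §2] -/
def Roberts1972_genericProjection : Prop :=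
  ∀ ⦃n : ℕ⦄ ⦃X : SchemeOver ℂ⦄, IsSmoothProjective n X → ∀ ⦃l k : ℕ⦄, 1 ≤ l →
    ∀ ⦃Z W : Set X.left⦄, IsClosed Z → IsIrreducible Z → (∀ z ∈ Z, (l : ℕ∞) ≤ coheight z) →
      (∃ z ∈ Z, coheight z ≤ (l : ℕ∞)) → IsClosed W → IsIrreducible W →
      (∀ w ∈ W, (k : ℕ∞) ≤ coheight w) → (∃ t ∈ Z ∩ W, coheight t < ((l + k : ℕ) : ℕ∞)) →
      ∃ (φ : X ⟶ projectiveSpace n ℂ) (_ : IsFinite φ.left) (Z' : Set X.left),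
        IsClosed Z' ∧ ¬ Z ⊆ Z' ∧ (∀ z ∈ Z', (l : ℕ∞) ≤ coheight z) ∧
        φ.left.base ⁻¹' (φ.left.base '' Z) ⊆ Z ∪ Z' ∧
        (∀ t' ∈ Z' ∩ W, ∃ t ∈ Z ∩ W, coheight t < coheight t') ∧
        ∃ U : X.left.Opens, (∃ z ∈ Z, z ∈ (U : Set X.left)) ∧ Smooth (U.ι ≫ φ.left)

end Literature.AlgebraicGeometry.Motives

end
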